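import Summits.NavierStokesRegularity.NavierStokesRegularity.Theorems.ScenarioCensusRowF1ax
import Summits.NavierStokesRegularity.NavierStokesRegularity.Theorems.ScenarioCensusRowA7h
import Summits.NavierStokesRegularity.NavierStokesRegularity.Theorems.DssFarFieldSlavingBlowupTypeIDssProfileSimilarityEnstrophyBeltramiLiouville
import Summits.NavierStokesRegularity.NavierStokesRegularity.Theorems.SqueezeCycleSingularZoomWindow
import Summits.NavierStokesRegularity.NavierStokesRegularity.Theorems.ClockStretchingLawClockCeilingZoomDerivLimit
import Summits.NavierStokesRegularity.NavierStokesRegularity.Theorems.PoloidalWindowDoorPoloidalWindowRigidityVorticityTranslate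
import Literature.Analysis.FluidPDE.TypeIAncientMild
import Literature.Analysis.FluidPDE.WholeSpaceIBP
import Literature.Analysis.FluidPDE.ClassicalSolutionCalculus
import Literature.Analysis.FluidPDE.VorticityEquation
import Literature.Analysis.FluidPDE.TypeIAncientMildClassical
import HarnessLib
import Summits.NavierStokesRegularity.NavierStokesRegularity.Theorems.ScenarioCensusRowF1IntStretchBudget

/-!
# Census row F1, family «DYNAMIC TOP / one-sided Lagrangian» (F1iq; floor DIVERGENT INTENSIFICATION) — LINE «integrated-quench» port, part 1/7: levels, the sharp Type-I
# constant, the third-order datum and the weight-6 read-out `intensOf` (§1); calculus of zooms up to third order (§2; shared lemmas BY NAME from the landed ports)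

Re-homed for the scenario census (typer seat ns-census-typer-1 g8; the cell F1iq and the floor DI are MEMBERS OF RECORD «DECIDED IN KERNEL IN FILES» of row F1 since
census v1.76 (critic idea-crit-3 g7 PASS — no price 01:59:11Z; ref ns-census-ref g9 PRE-CHECK ✓ §14.27 item 35; lead-presearch label); this port makes them TREE-decided):
VERBATIM PORT of ns-idea-3 LINE 22 «integrated-quench», `pub/ideators/ns-idea-3/lines/integrated-quench/line-integrated-quench.lean` sha16 d7402efa28ebc137 (2066 l.,
lean check rc 0, 0 sorry), split for the 400-line rule into seven parts `ScenarioCensusRowF1IntQuench{∅, Kill, Cutoff, Enstrophy, Liouville, Transfer, Top}` (chain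
imports).  Lean text VERBATIM in namespace `…Theorems.ScenarioCensus.IntegratedQuench` (the line's `…Cruxes.ScenarioCensusRowF1.IntegratedQuenchLine` re-homed); port
edits: the bracket lines `section IntegralTransfer` / `end IntegralTransfer` dropped (no `variable`s), `@[conjecture]` on the residual `IqSlack` (≡ `ScenarioCensus.Row_F1`,
OPEN), forty-five one-line docstrings added (gate lint); lemmas the line shares VERBATIM with the landed inviscid-top / frozen-top / columnar-top / stretched-top /
integrated-stretch ports are taken BY NAME (listed below); `norm_laplacian_curl_le` (twin of the tree's `clockAP_norm_laplacian_curl_le`, whose module has no farm build) is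
not re-declared and its single use carries the line's own proof as a local `have` (proof text only).  Statements untouched.

No census VALUE is moved here (row F1 stays OPEN-WITH-LINE; the members become TREE-decided by name); NS regularity is NOT proved; `Row_F1` is untouched
(zero movement, `iqSlack_iff_rowF1`); no summit statement is proved by this file. Lemmas that restate already-landed tree declarations are taken BY NAME (gate lint `dedup.landed`): `convect_curl_self` = `FrozenTop.convect_curl_self`, `fderiv_smul_stPull_apply` = `InviscidTop.fderiv_smul_stPull_apply`, `fderiv_smul_stPull` = `InviscidTop.fderiv_smul_stPull`, `fderiv_fderiv_smul_stPull` = `InviscidTop.fderiv_fderiv_smul_stPull`, `tendsto_clm_of_tendsto_apply` = `InviscidTop.tendsto_clm_of_tendsto_apply`, `tendsto_fderiv_fderiv_apply_of_bound` = `InviscidTop.tendsto_fderiv_fderiv_apply_of_bound`, `tendsto_fderiv_fderiv_of_bound` = `InviscidTop.tendsto_fderiv_fderiv_of_bound`, `tendsto_fderiv_fderiv_of_typeI_seq_Ioo` = `InviscidTop.tendsto_fderiv_fderiv_of_typeI_seq_Ioo`, `fderiv3_smul_stPull` = `FrozenTop.fderiv3_smul_stPull`, `tendsto_fderiv3_of_typeI_seq_Ioo`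 = `FrozenTop.tendsto_fderiv3_of_typeI_seq_Ioo`, `tendsto_physicalTime` = `ColumnarTop.tendsto_physicalTime`, `eventually_fast` = `ColumnarTop.eventually_fast`, `sqrt_timeLag` = `StretchedTop.sqrt_timeLag`, `forall_of_forall_ne_zero` = `StretchedTop.forall_of_forall_ne_zero`, `radius_eq` = `FrozenTop.radius_eq`, `jointCond_everywhere₆` = `FrozenTop.jointCond_everywhere₄`, `continuousOn_quad` = `IntegratedStretch.continuousOn_quad`, `sqrt_nu_timeLag` = `IntegratedStretch.sqrt_nu_timeLag`, `continuous_maxRdnu` = `IntegratedStretch.continuous_maxRdnu`, `sing_of_not_bounded` = `InviscidTop.sing_of_not_bounded`, `nonIntensifying_ancient_trivial` = `eq_zero_of_nonIntensifying`, `vort_eq` = `FrozenTop.freeze_eq`, `exists_singularZoom_package₃` = `FrozenTop.exists_singularZoom_package₃`, `lapD_eq_zero_of_eq_zero` = `FrozenTop.lapD_eq_zero_of_eq_zero`.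
-/

-- the summit and its single problem share the name `NavierStokesRegularity` (D-0017 nested layout)
set_option linter.dupNamespace false

noncomputable section

open MeasureTheory Set Function Filter TopologicalSpace Metric
open scoped Topology NNReal ENNReal InnerProductSpace RealInnerProductSpace Laplacian

namespace Summit.NavierStokesRegularity.NavierStokesRegularity.Theorems.ScenarioCensus.IntegratedQuench

open Literature.Analysis Literature.Analysis.FluidPDE
open Summit.NavierStokesRegularity.NavierStokesRegularity.Theorems

/-- `ℝ³`. -/
abbrev E3 := EuclideanSpace ℝ (Fin 3)

/-- The space of Hessians `D²v(x) : ℝ³ →L (ℝ³ →L ℝ³)`. -/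
abbrev Hess := E3 →L[ℝ] E3 →L[ℝ] E3

/-- The coordinate unit vectors. -/
abbrev eI (i : Fin 3) : E3 := EuclideanSpace.single i (1 : ℝ)

/-! ## §1 Levels, the sharp Type-I constant; the third-order datum `K = Σᵢ D³v(eᵢ,eᵢ,·)` and the weight-6
INTENSIFICATION read-out `𝓘 = ⟪ω, Δω + (ω·∇)v⟫ = ½ Dₜ|ω|²`; the vorticity-equation dictionary (LINE 21 §1, trimmed to
what the integrated rows use; re-proved verbatim so that the file stands alone) -/

/-- **Subcritical (moving) speed level**: `Λ(t) √(T − t) → 0` as `t ↑ T`. -/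
def IsSubcriticalLevel (T : ℝ) (Λ : ℝ → ℝ) : Prop :=
  Tendsto (fun t => Λ t * Real.sqrt (T - t)) (𝓝[<] T) (𝓝 0)

/-- **Type-I blow-up with dimensionless constant `M`**: eventually `√(T − t) ‖u(t, x)‖ ≤ M √ν`. -/
def IsTypeIBlowupWith (M ν : ℝ) (u : ℝ → E3 → E3) (T : ℝ) : Prop :=
  ∀ᶠ t in 𝓝[<] T, ∀ x : E3, Real.sqrt (T - t) * ‖u t x‖ ≤ M * Real.sqrt ν

/-- **Third-order datum**: the trace `Σᵢ D³v(x) eᵢ eᵢ ∈ L(ℝ³)` of the third derivative in its two outer slots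
(for smooth `v` this is `D(Δv)(x)`; only the trace of `D³v` enters the vorticity equation). -/
def lapD (v : E3 → E3) (x : E3) : E3 →L[ℝ] E3 := ∑ i, fderiv ℝ (fderiv ℝ (fderiv ℝ v)) x (eI i) (eI i)

/-- **Intensification read-out** of (value, gradient, Hessian, third-order datum): the scalar
`⟪curl L, curl K + L (curl L)⟫` — at `x`, with `L = ∇v(x)`, `K = Σᵢ D³v(x) eᵢ eᵢ`, this is `⟪ω, Δω + (ω·∇)v⟫(x)`, i.e.
`⟪ω, ∂ₛω + (v·∇)ω⟫ = ½ (∂ₛ + v·∇)|ω|²` for a solution of the unit-viscosity vorticity equation: HALF THE MATERIAL RATE OF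
THE ENSTROPHY DENSITY.  It does not depend on the value `v` and the Hessian `H` (kept for the joint engine). -/
def intensOf (_v : E3) (L : E3 →L[ℝ] E3) (_H : Hess) (K : E3 →L[ℝ] E3) : ℝ :=
  ⟪curlCLM L, curlCLM K + L (curlCLM L)⟫

/-- Weight-6 homogeneity under the `𝒦`-scaling `(v, L, H, K) ↦ (a v, a² L, a³ H, a⁴ K)`. -/
theorem intensOf_smul {a : ℝ} (v : E3) (L : E3 →L[ℝ] E3) (H : Hess) (K : E3 →L[ℝ] E3) :
    intensOf (a • v) (a ^ 2 • L) (a ^ 3 • H) (a ^ 4 • K) = a ^ 6 * intensOf v L H K := by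
  simp only [intensOf, _root_.smul_apply, ContinuousLinearMap.map_smul, smul_smul, inner_add_right,
    real_inner_smul_left, real_inner_smul_right]
  ring

/-- The read-out `intensOf` is continuous. -/
theorem continuous_intensOf :
    Continuous fun q : E3 × (E3 →L[ℝ] E3) × Hess × (E3 →L[ℝ] E3) => intensOf q.1 q.2.1 q.2.2.1 q.2.2.2 := by
  have hc : Continuous (curlCLM : (E3 →L[ℝ] E3) →L[ℝ] E3) := curlCLM.continuous
  have h1 : Continuous fun q : E3 × (E3 →L[ℝ] E3) × Hess × (E3 →L[ℝ] E3) => curlCLM q.2.2.2 :=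
    hc.comp continuous_snd.snd.snd
  have hL : Continuous fun q : E3 × (E3 →L[ℝ] E3) × Hess × (E3 →L[ℝ] E3) => curlCLM q.2.1 :=
    hc.comp continuous_snd.fst
  have h3 : Continuous fun q : E3 × (E3 →L[ℝ] E3) × Hess × (E3 →L[ℝ] E3) => q.2.1 (curlCLM q.2.1) :=
    continuous_snd.fst.clm_apply hL
  exact hL.inner (h1.add h3)

/-- `intensOf` vanishes at the zero datum. -/
theorem intensOf_zero : intensOf 0 0 0 0 = 0 := by simp [intensOf]

/-- `Δ(curl v)(x) = curl (Σᵢ D³v(x) eᵢ eᵢ)` for `C³` fields. -/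
theorem laplacian_curl_eq {v : E3 → E3} (hv : ContDiff ℝ 3 v) (x : E3) : (Δ (curl v)) x = curlCLM (lapD v x) := by
  rw [InnerProductSpace.laplacian_eq_iteratedFDeriv_orthonormalBasis (curl v) (EuclideanSpace.basisFun (Fin 3) ℝ)]
  simp only [lapD, map_sum]
  refine Finset.sum_congr rfl fun i _ => ?_
  have hf : ContDiff ℝ 2 (fderiv ℝ v) := hv.fderiv_right (by norm_cast)
  rw [curl_eq_curlCLM_comp, ContinuousLinearMap.iteratedFDeriv_comp_left curlCLM hf.contDiffAt le_rfl,
    ContinuousLinearMap.compContinuousMultilinearMap_coe, Function.comp_apply, iteratedFDeriv_two_apply,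
    EuclideanSpace.basisFun_apply]
  rfl

-- `convect_curl_self`: the line restates the tree's `FrozenTop.convect_curl_self`; taken BY NAME (gate lint dedup.landed).

/-- `curl v (x) = curl (Dv(x))` (definitional). -/
theorem curl_apply_eq (v : E3 → E3) (x : E3) : curl v x = curlCLM (fderiv ℝ v x) := rfl

/-- `⟪ω, Δω + (ω·∇)v⟫(x)` is the read-out `intensOf` of `(v, ∇v, ∇²v, Σᵢ D³v eᵢ eᵢ)(x)` (`ω = curl v`, `C³` fields). -/
theorem intens_eq {v : E3 → E3} (hv : ContDiff ℝ 3 v) (x : E3) :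
    ⟪curl v x, (Δ (curl v)) x + convect (curl v) v x⟫ =
      intensOf (v x) (fderiv ℝ v x) (fderiv ℝ (fderiv ℝ v) x) (lapD v x) := by
  rw [intensOf, laplacian_curl_eq hv, FrozenTop.convect_curl_self, curl_apply_eq]

/-- `ν`-normalisation: `ν³ w · intensOf(u/ν, ∇u/ν, ∇²u/ν, K/ν) = w ⟪ω, ν Δω + (ω·∇)u⟫`. -/
theorem nu_readout_intensOf {ν : ℝ} (hν : 0 < ν) (w : ℝ) {v : E3 → E3} (hv : ContDiff ℝ 3 v) (x : E3) :
    ν ^ 3 * w * intensOf (ν⁻¹ • v x) (ν⁻¹ • fderiv ℝ v x) (ν⁻¹ • fderiv ℝ (fderiv ℝ v) x) (ν⁻¹ • lapD v x) =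
      w * ⟪curl v x, ν • (Δ (curl v)) x + convect (curl v) v x⟫ := by
  rw [laplacian_curl_eq hv, FrozenTop.convect_curl_self, curl_apply_eq]
  simp only [intensOf, _root_.smul_apply, ContinuousLinearMap.map_smul, smul_smul, inner_add_right,
    real_inner_smul_left, real_inner_smul_right]
  field_simp

/-! ### Constant levels; the sharp Type-I constant of a Type-I blow-up -/

/-- Constant levels are subcritical. -/
theorem isSubcriticalLevel_const (T Λ : ℝ) : IsSubcriticalLevel T (fun _ => Λ) := by
  have h : Tendsto (fun t : ℝ => Λ * Real.sqrt (T - t)) (𝓝 T) (𝓝 (Λ * Real.sqrt (T - T))) :=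
    ((continuous_const.sub continuous_id).sqrt.tendsto T).const_mul Λ
  rw [sub_self, Real.sqrt_zero, mul_zero] at h
  exact h.mono_left nhdsWithin_le_nhds

/-- A dimensionless Type-I bound is a Type-I bound. -/
theorem IsTypeIBlowupWith.isTypeIBlowup {M ν T : ℝ} {u : ℝ → E3 → E3} (h : IsTypeIBlowupWith M ν u T) :
    IsTypeIBlowup u T := by
  refine ⟨M * Real.sqrt ν, ?_⟩
  filter_upwards [h, self_mem_nhdsWithin] with t ht htT x
  have htT' : t < T := htT
  have hs : 0 < Real.sqrt (T - t) := Real.sqrt_pos.2 (sub_pos.2 htT')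
  rw [le_div_iff₀ hs, mul_comm]
  exact ht x

/-- Every Type-I blow-up has a dimensionless constant (`M = C/√ν`). -/
theorem exists_isTypeIBlowupWith {ν T : ℝ} (hν : 0 < ν) {u : ℝ → E3 → E3} (h : IsTypeIBlowup u T) :
    ∃ M : ℝ, IsTypeIBlowupWith M ν u T := by
  obtain ⟨C, hC⟩ := h
  refine ⟨C / Real.sqrt ν, ?_⟩
  have hsν : 0 < Real.sqrt ν := Real.sqrt_pos.2 hν
  filter_upwards [hC, self_mem_nhdsWithin] with t ht htT x
  have htT' : t < T := htT
  have hs : 0 < Real.sqrt (T - t) := Real.sqrt_pos.2 (sub_pos.2 htT')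
  rw [div_mul_cancel₀ C hsν.ne']
  have h1 := ht x
  rw [le_div_iff₀ hs] at h1
  rw [mul_comm]
  exact h1

/-! ### The vorticity-equation dictionary: dynamic = kinematic for classical solutions -/

-- `vort_eq`: the line restates the tree's `FrozenTop.freeze_eq`; taken BY NAME (gate lint dedup.landed).

/-- `∂ₜω + (u·∇)ω = ν Δω + (ω·∇)u` on `[0, T)` (the vorticity equation, rearranged). -/
theorem quench_eq {ν T : ℝ} (hT : 0 < T) {u : ℝ → E3 → E3} {p : ℝ → E3 → ℝ}
    (hsol : IsClassicalNSSolutionOn (Ico 0 T) ν 0 u p) {t : ℝ} (ht : t ∈ Ico 0 T) (x : E3) :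
    timeDerivWithin (Ico 0 T) (vorticity u) t x + convect (u t) (curl (u t)) x =
      ν • (Δ (curl (u t))) x + convect (curl (u t)) (u t) x := by
  rw [← FrozenTop.freeze_eq hT hsol ht x]
  abel

/-! ## §2 Calculus of zooms up to third order; the `C²_loc` tool (LINE 18) and the `C³_loc` tool (LINE 20), re-proved verbatim -/

-- `fderiv_smul_stPull_apply`: the line restates the tree's `InviscidTop.fderiv_smul_stPull_apply`; taken BY NAME (gate lint dedup.landed).

-- `fderiv_smul_stPull`: the line restates the tree's `InviscidTop.fderiv_smul_stPull`; taken BY NAME (gate lint dedup.landed).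

-- `fderiv_fderiv_smul_stPull`: the line restates the tree's `InviscidTop.fderiv_fderiv_smul_stPull`; taken BY NAME (gate lint dedup.landed).

-- `fderiv3_smul_stPull`: the line restates the tree's `FrozenTop.fderiv3_smul_stPull`; taken BY NAME (gate lint dedup.landed).

/-- The third-order datum of a rescaled field. -/
theorem lapD_smul_stPull (a β γ t₀ : ℝ) (x₀ : E3) (ψ : ℝ → E3 → E3) (s : ℝ) (y : E3) :
    lapD ((a • stPull β γ t₀ x₀ ψ) s) y = (a * γ * γ * γ) • lapD (ψ (t₀ + β * s)) (x₀ + γ • y) := by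
  simp only [lapD, FrozenTop.fderiv3_smul_stPull, _root_.smul_apply, Finset.smul_sum]

-- `tendsto_clm_of_tendsto_apply`: the line restates the tree's `InviscidTop.tendsto_clm_of_tendsto_apply`; taken BY NAME (gate lint dedup.landed).

-- `tendsto_fderiv_fderiv_apply_of_bound`: the line restates the tree's `InviscidTop.tendsto_fderiv_fderiv_apply_of_bound`; taken BY NAME (gate lint dedup.landed).

-- `tendsto_fderiv_fderiv_of_bound`: the line restates the tree's `InviscidTop.tendsto_fderiv_fderiv_of_bound`; taken BY NAME (gate lint dedup.landed).

/-! ### Hessian (`C²_loc`) convergence of Type-I mild sequences (LINE 18's extraction tool) -/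

-- `tendsto_fderiv_fderiv_of_typeI_seq_Ioo`: the line restates the tree's `InviscidTop.tendsto_fderiv_fderiv_of_typeI_seq_Ioo`; taken BY NAME (gate lint dedup.landed).

/-! ### Third-order (`C³_loc`) convergence of Type-I mild sequences (LINE 20's extraction tool) -/

-- `tendsto_fderiv3_of_typeI_seq_Ioo`: the line restates the tree's `FrozenTop.tendsto_fderiv3_of_typeI_seq_Ioo`; taken BY NAME (gate lint dedup.landed).

/-- **Convergence of the third-order data** `Σᵢ D³wₖ(t)(x) eᵢ eᵢ → Σᵢ D³W(t)(x) eᵢ eᵢ`. -/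
theorem tendsto_lapD_of_typeI_seq_Ioo {C C' : ℝ} {A : ℕ → ℝ} (hA : Tendsto A atTop atBot)
    {w : ℕ → ℝ → E3 → E3}
    (hc : ∀ k, ContinuousOn (uncurry (w k)) (Ioo (A k) 0 ×ˢ univ))
    (hdivw : ∀ k, ∀ t ∈ Ioo (A k) 0, IsWeaklyDivFree (w k t))
    (hmild : ∀ k, ∀ s t : ℝ, A k < s → s < t → t < 0 → ∀ x,
      w k t x = UnboundedOperators.heatExtension (w k s) (t - s) x - oseenDuhamel 1 s (w k) (w k) t x)
    (hI : ∀ k, ∀ t ∈ Ioo (A k) 0, ∀ x, ‖w k t x‖ ≤ C / Real.sqrt (-t))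
    {W : ℝ → E3 → E3} (hW : IsTypeIAncientMild C' W)
    (hgrad : ∀ t < 0, ∀ x, Tendsto (fun k => fderiv ℝ (w k t) x) atTop (𝓝 (fderiv ℝ (W t) x))) :
    ∀ t < 0, ∀ x, Tendsto (fun k => lapD (w k t) x) atTop (𝓝 (lapD (W t) x)) := by
  intro t ht x
  unfold lapD
  refine tendsto_finsetSum _ fun i _ => ?_
  exact ((ContinuousLinearMap.apply ℝ (E3 →L[ℝ] E3) (eI i)).continuous.tendsto _).comp
    (FrozenTop.tendsto_fderiv3_of_typeI_seq_Ioo hA hc hdivw hmild hI hW hgrad t ht x (eI i))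

end Summit.NavierStokesRegularity.NavierStokesRegularity.Theorems.ScenarioCensus.IntegratedQuench

end
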